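/-
Copyright (c) 2026 the pub-hodgecm-mathlib formalisation cell (harness21).  Prover seat hodgecm-mathlib-R90-C10-p07 (g0) acting for R90-TF section S8 «ContSpec-n½»
(dealer R90-CS-plan (g2), S8-R43 booking «split sequel», file 1 of 2): the Gindikin–Karpelevich computation for `GL₃` over a non-archimedean local field with TWO
COMPLEX exponents — the local factor of the `χ`-twisted intertwining Euler product of `U(2,1)` at a SPLIT place.
-/
import Summits.HodgeConjecture.HodgeConjecture.Theorems.K2E1GindikinKarpelevichSplitGL3Haar   -- ★ one-exponent real GK on `F × (F × F)` (integrability `integrable_bigCellIntegrand`, ultrametric algebra)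
import Summits.HodgeConjecture.HodgeConjecture.Theorems.K2E1FiniteWhittakerInertU3            -- ★ `integral_max_one_max_normAbs_cpow_neg` (the floor lemma at a COMPLEX exponent)
import Summits.HodgeConjecture.HodgeConjecture.Theorems.K2LiuGKRankOneIntegral                -- ★ `integrable_and_integral_max_one_normAbs_cpow` (Tate's `G(w)`, `1 < Re w`)
import HarnessLib

/-!
# K2·E1 ∕ R90·S8 — `K2E1GindikinKarpelevichSplitGL3Cpow`: GINDIKIN–KARPELEVICH FOR `GL₃(F)` WITH TWO COMPLEX EXPONENTS —
# `∫_{F³} max(1,|x|,|z|)^{−a}·max(1,|y|,|z−xy|)^{−b} = G(a)·G(b)·G(a+b−1)`, `G(w) = ∫ max(1,|t|)^{−w} = μ(𝒪)(1−q^{−w})∕(1−q^{1−w})`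

Cell `pub/hodgecm-mathlib`, crux h413 = `stmt-HodgeConjecture-24833`, route of record `HCCMUnconditional`; R90-TF section S8, the SPLIT sequel of ★ `K2E1ChiIntertwiningLocalScalarU3`
(B1-local; census `R90/S8/CENSUS-sock3-piN.R90-C10-p07-g0.md` B1, file 1 of 2 — file 2 `K2E1ChiIntertwiningLocalScalarSplitU3` transports this to the split place of `U(2,1)`).
THEOREMS ONLY (no `def`, no `instance`, no notation, no named-fact hypothesis, no `sorry`; default heartbeats); lane `--supports stmt-HodgeConjecture-24833 --as helper`.

THE MATHEMATICS ([Langlands1971] §3; [Casselman1980] Thm 3.1; [MoeglinWaldspurger1995] II.1.7).  On the big cell of `GL₃(F)`, `n(x,y,z) ↦ w₀n` has bottom row `(1,x,z)` and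
bottom minors `(1, y, z−xy)`, so a flat section with exponents `a` (on `|b₃₃|⁻¹`) and `b` (on `|b₂₂b₃₃|⁻¹`) evaluates to `max(1,|x|,|z|)^{−a}·max(1,|y|,|z−xy|)^{−b}`;
★ `K2E1GindikinKarpelevichSplitGL3` is the case `a = b = σ` real.  Here `a, b ∈ ℂ` are INDEPENDENT (the `χ`-twisted split place of `U(2,1)` needs `a = z + tI`, `b = z − tI`):
the same INTEGRABILITY-FREE reduction `M(w₀) = M(s₁)M(s₂)M(s₁)` — inner `y`-integral `max(1,|z|)^{1−b}G(b)` (`|x| ≤ 1`) ∕ `|x|⁻¹max(1,|x⁻¹z|)^{1−b}G(b)` (`|x| > 1`) by ★'s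
ultrametric algebra and the ★ COMPLEX floor lemma; the fibre over `x` is `max(1,|x|)^{−a}·G(b)·G(a+b−1)` (`m^{−a}·m^{1−b} = m^{−(a+b−1)}`); integrating in `x`:
**`∫_x∫_z∫_y = G(a)·G(b)·G(a+b−1)`** (all `a b : ℂ`), and for `1 < Re a`, `1 < Re b` the CLOSED FORM
**`μ(𝒪)³ · (1−q^{−a})(1−q^{−b})(1−q^{−(a+b−1)}) ∕ ((1−q^{1−a})(1−q^{1−b})(1−q^{−(a+b−2)}))`** (★ Tate `G(w)` at `w = a, b, a+b−1`) — the three positive roots `e₁−e₂ ↦ a`,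
`e₂−e₃ ↦ b`, `e₁−e₃ ↦ a+b−1`; at `a = b = σ` it is ★'s `G(σ)²G(2σ−1)`.  §5 moves the iterated identity onto `F × (F × F)` with `μ ⊗ (μ ⊗ μ)` (Fubini twice; integrability for
`1 < Re a, Re b` by domination with ★ `integrable_bigCellIntegrand` at `σ₀ = min(Re a, Re b)`).
HONEST LABEL: HC_CM is proved only modulo the 7 printed citations (2 remaining named inputs: hLiu418 = `stmt-HodgeConjecture-24832`, h413 = `stmt-HodgeConjecture-24833`) until rung 0
closes; this file asserts no named fact and closes no socket; count-neutral; unconditional local analysis.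

* §1 `cpow` bookkeeping on real bases `≥ 1`.  * §2 `integral_inner_cpow_of_le_one`, `integral_inner_cpow_of_one_lt`.  * §3 `integral_integral_bigCellFibre_cpow_eq`.
* §4 `integral_bigCell_gl3_cpow_eq_prod`, **`integral_bigCell_gl3_cpow_eq`**.  * §5 `integrable_bigCellIntegrand_cpow`, **`integral_prod_bigCell_gl3_cpow_eq`** (product measure).

## References
* [Langlands1971] R. P. Langlands, *Euler Products* (1971), §3.
* [Casselman1980] W. Casselman, *The unramified principal series of p-adic groups I*, Compositio Math. 40 (1980), Thm 3.1.
* [MoeglinWaldspurger1995] C. Mœglin, J.-L. Waldspurger, *Spectral Decomposition and Eisenstein Series* (1995), II.1.7.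
* [Tate1950] J. Tate, *Fourier analysis in number fields and Hecke's zeta-functions* (1950), §2.2.
-/

set_option autoImplicit false
set_option linter.dupNamespace false -- the mandated namespace repeats `HodgeConjecture.HodgeConjecture`

noncomputable section

open MeasureTheory Filter Topology Set TopologicalSpace
open scoped NNReal ENNReal
open Literature.NumberTheory.GaloisRepresentations Literature.NumberTheory.GaloisRepresentations.IsNonarchimedeanLocalField
open Literature.NumberTheory.Automorphic Literature.NumberTheory.Automorphic.LocalFieldHaar
open Summit.HodgeConjecture.HodgeConjecture.Cruxes.H413.K2E1GindikinKarpelevichSplitGL3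
  (max_normAbs_sub_mul_of_le_one max_normAbs_add_mul_of_one_le max_one_max_eq_mul max_one_max_eq_of_le_one)
open Summit.HodgeConjecture.HodgeConjecture.Cruxes.H413.K2E1GindikinKarpelevichSplitGL3Haar (integrable_bigCellIntegrand integrable_zySection continuous_coe_normAbs)
open Summit.HodgeConjecture.HodgeConjecture.Cruxes.H413.K2E1FiniteWhittakerInertU3 (integral_max_one_max_normAbs_cpow_neg)
open Summit.HodgeConjecture.HodgeConjecture.Cruxes.HLiu418.K2LiuGKRankOneIntegral (integrable_and_integral_max_one_normAbs_cpow)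

namespace Summit.HodgeConjecture.HodgeConjecture.Cruxes.H413.K2E1GindikinKarpelevichSplitGL3Cpow

variable {F : Type*} [Field F] [ValuativeRel F] [TopologicalSpace F] [IsNonarchimedeanLocalField F]

/-! ## §1 `cpow` bookkeeping on real bases `≥ 1` -/

/-- For a real `m ≥ 1` and complex `a b`: `m^{−a}·m^{1−b} = m^{−(a+b−1)}` in `ℂ`. [folklore] -/
theorem coe_cpow_neg_mul_cpow_one_sub {m : ℝ} (hm : 1 ≤ m) (a b : ℂ) :
    ((m : ℂ) ^ (-a)) * ((m : ℂ) ^ (1 - b)) = (m : ℂ) ^ (-(a + b - 1)) := by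
  have hm0 : (m : ℂ) ≠ 0 := by exact_mod_cast (lt_of_lt_of_le one_pos hm).ne'
  rw [← Complex.cpow_add _ _ hm0]
  congr 1
  ring

/-- The norm of `m^{−a}` for a real `m ≥ 1`: `‖(m:ℂ)^{−a}‖ = m^{−Re a} ≤ m^{−σ}` whenever `σ ≤ Re a`. [folklore] -/
theorem norm_coe_cpow_neg_le {m : ℝ} (hm : 1 ≤ m) {a : ℂ} {σ : ℝ} (hσ : σ ≤ a.re) :
    ‖(m : ℂ) ^ (-a)‖ ≤ m ^ (-σ) := by
  rw [Complex.norm_cpow_eq_rpow_re_of_pos (lt_of_lt_of_le one_pos hm), Complex.neg_re]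
  exact Real.rpow_le_rpow_of_exponent_le hm (by linarith)

/-- Continuity of `t ↦ ((max 1 f(t) : ℝ) : ℂ)^w` for a continuous real `f` (the base lies in the slit plane). [folklore] -/
theorem continuous_coe_max_one_cpow {X : Type*} [TopologicalSpace X] {f : X → ℝ} (hf : Continuous f) (w : ℂ) :
    Continuous fun x => (((max 1 (f x) : ℝ)) : ℂ) ^ w :=
  Continuous.cpow (Complex.continuous_ofReal.comp (continuous_const.max hf)) continuous_const
    fun _ => Complex.ofReal_mem_slitPlane.2 (lt_of_lt_of_le one_pos (le_max_left _ _))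

section Haar

variable [MeasurableSpace F] [BorelSpace F] (μ : Measure F) [μ.IsAddHaarMeasure]

/-! ## §2 The inner `y`-integral at a complex exponent -/

/-- The inner `y`-integral for `|x| ≤ 1`, complex exponent: **`∫ max(1,|y|,|z−xy|)^{−b} dy = max(1,|z|)^{1−b}·G(b)`** (★ `max_normAbs_sub_mul_of_le_one`: the perturbation is
absorbed; ★ complex floor lemma). [cite: Casselman1980, Thm. 3.1] -/
theorem integral_inner_cpow_of_le_one {x : F} (hx : normAbs F x ≤ 1) (z : F) (b : ℂ) :
    ∫ y, ((max 1 (max ((normAbs F y : ℝ≥0) : ℝ) ((normAbs F (z - x * y) : ℝ≥0) : ℝ)) : ℝ) : ℂ) ^ (-b) ∂μ =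
      (((max 1 ((normAbs F z : ℝ≥0) : ℝ)) : ℝ) : ℂ) ^ (1 - b) * ∫ t, (((max 1 ((normAbs F t : ℝ≥0) : ℝ) : ℝ) : ℂ) ^ (-b)) ∂μ := by
  have hpt : ∀ y : F, max ((normAbs F y : ℝ≥0) : ℝ) ((normAbs F (z - x * y) : ℝ≥0) : ℝ) =
      max ((normAbs F z : ℝ≥0) : ℝ) ((normAbs F y : ℝ≥0) : ℝ) := by
    intro y
    rw [← NNReal.coe_max, max_normAbs_sub_mul_of_le_one hx, NNReal.coe_max, max_comm]
  simp_rw [hpt]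
  exact integral_max_one_max_normAbs_cpow_neg μ z b

/-- The inner `y`-integral for `|x| > 1`, complex exponent: **`∫ max(1,|y|,|z−xy|)^{−b} dy = |x|⁻¹·max(1,|x⁻¹z|)^{1−b}·G(b)`** (translate `y ↦ x⁻¹z + y`, ★
`max_normAbs_add_mul_of_one_le`, rescale `y ↦ x⁻¹y`, ★ complex floor lemma). [cite: Casselman1980, Thm. 3.1] [cite: Tate1950, §2.2 Lemma 2.2.5] -/
theorem integral_inner_cpow_of_one_lt {x : F} (hx : 1 < normAbs F x) (z : F) (b : ℂ) :
    ∫ y, ((max 1 (max ((normAbs F y : ℝ≥0) : ℝ) ((normAbs F (z - x * y) : ℝ≥0) : ℝ)) : ℝ) : ℂ) ^ (-b) ∂μ =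
      ((((normAbs F x : ℝ≥0) : ℝ)⁻¹ : ℝ) : ℂ) * ((((max 1 ((normAbs F (x⁻¹ * z) : ℝ≥0) : ℝ)) : ℝ) : ℂ) ^ (1 - b) *
        ∫ t, (((max 1 ((normAbs F t : ℝ≥0) : ℝ) : ℝ) : ℂ) ^ (-b)) ∂μ) := by
  have hx0 : x ≠ 0 := by
    rintro rfl
    rw [map_zero] at hx
    exact not_lt.2 zero_le_one hx
  have hpt : ∀ y : F, max ((normAbs F y : ℝ≥0) : ℝ) ((normAbs F (z - x * y) : ℝ≥0) : ℝ) =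
      max ((normAbs F y : ℝ≥0) : ℝ) (((normAbs F x : ℝ≥0) : ℝ) * ((normAbs F (x⁻¹ * z - y) : ℝ≥0) : ℝ)) := by
    intro y
    rw [show z - x * y = x * (x⁻¹ * z - y) by rw [mul_sub, mul_inv_cancel_left₀ hx0], map_mul, NNReal.coe_mul]
  simp_rw [hpt]
  rw [← integral_add_left_eq_self _ (x⁻¹ * z)]
  have hpt2 : ∀ y : F, max ((normAbs F (x⁻¹ * z + y) : ℝ≥0) : ℝ) (((normAbs F x : ℝ≥0) : ℝ) * ((normAbs F (x⁻¹ * z - (x⁻¹ * z + y)) : ℝ≥0) : ℝ)) =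
      max ((normAbs F (x⁻¹ * z) : ℝ≥0) : ℝ) ((normAbs F (x * y) : ℝ≥0) : ℝ) := by
    intro y
    rw [show x⁻¹ * z - (x⁻¹ * z + y) = -y by abel, normAbs_neg, ← NNReal.coe_mul, ← NNReal.coe_max,
      max_normAbs_add_mul_of_one_le hx.le, ← map_mul, NNReal.coe_max]
  simp_rw [hpt2]
  have hsub := integral_comp_mul_left μ hx0 (fun t => ((max 1 (max ((normAbs F (x⁻¹ * z) : ℝ≥0) : ℝ) ((normAbs F t : ℝ≥0) : ℝ)) : ℝ) : ℂ) ^ (-b))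
  have hinv : ((normAbs F x⁻¹ : ℝ≥0) : ℝ) = ((normAbs F x : ℝ≥0) : ℝ)⁻¹ := by rw [map_inv₀, NNReal.coe_inv]
  simp only [hinv, Complex.real_smul] at hsub
  rw [hsub, integral_max_one_max_normAbs_cpow_neg μ (x⁻¹ * z) b]

/-! ## §3 The fibre over `x` -/

/-- **THE FIBRE OVER `x` AT TWO COMPLEX EXPONENTS**: for every `x : F` and all `a b : ℂ`,
`∫_z ∫_y max(1,|x|,|z|)^{−a}·max(1,|y|,|z−xy|)^{−b} dy dz = max(1,|x|)^{−a} · G(b) · G(a+b−1)` (§2; for `|x| > 1` rescale `z ↦ x·z`; `m^{−a}·m^{1−b} = m^{−(a+b−1)}`).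
[cite: Langlands1971, §3] [cite: Casselman1980, Thm. 3.1] -/
theorem integral_integral_bigCellFibre_cpow_eq (a b : ℂ) (x : F) :
    ∫ z, ∫ y, ((max 1 (max ((normAbs F x : ℝ≥0) : ℝ) ((normAbs F z : ℝ≥0) : ℝ)) : ℝ) : ℂ) ^ (-a) *
        ((max 1 (max ((normAbs F y : ℝ≥0) : ℝ) ((normAbs F (z - x * y) : ℝ≥0) : ℝ)) : ℝ) : ℂ) ^ (-b) ∂μ ∂μ =
      (((max 1 ((normAbs F x : ℝ≥0) : ℝ) : ℝ) : ℂ) ^ (-a)) *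
        ((∫ t, (((max 1 ((normAbs F t : ℝ≥0) : ℝ) : ℝ) : ℂ) ^ (-b)) ∂μ) * ∫ t, (((max 1 ((normAbs F t : ℝ≥0) : ℝ) : ℝ) : ℂ) ^ (-(a + b - 1))) ∂μ) := by
  have hpow : ∀ u : F, (((max 1 ((normAbs F u : ℝ≥0) : ℝ) : ℝ) : ℂ) ^ (-a)) * (((max 1 ((normAbs F u : ℝ≥0) : ℝ) : ℝ) : ℂ) ^ (1 - b)) =
      (((max 1 ((normAbs F u : ℝ≥0) : ℝ) : ℝ) : ℂ) ^ (-(a + b - 1))) := fun u => coe_cpow_neg_mul_cpow_one_sub (le_max_left _ _) a b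
  simp_rw [integral_const_mul]
  rcases le_or_gt (normAbs F x) 1 with hx | hx
  · -- `|x| ≤ 1`: no rescaling
    have hx' : ((normAbs F x : ℝ≥0) : ℝ) ≤ 1 := by exact_mod_cast hx
    simp_rw [integral_inner_cpow_of_le_one μ hx, max_one_max_eq_of_le_one hx']
    rw [max_eq_left hx', Complex.ofReal_one, Complex.one_cpow, one_mul]
    have hpt : ∀ z : F, (((max 1 ((normAbs F z : ℝ≥0) : ℝ) : ℝ) : ℂ) ^ (-a)) *
        ((((max 1 ((normAbs F z : ℝ≥0) : ℝ)) : ℝ) : ℂ) ^ (1 - b) * ∫ t, (((max 1 ((normAbs F t : ℝ≥0) : ℝ) : ℝ) : ℂ) ^ (-b)) ∂μ) =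
        (∫ t, (((max 1 ((normAbs F t : ℝ≥0) : ℝ) : ℝ) : ℂ) ^ (-b)) ∂μ) * (((max 1 ((normAbs F z : ℝ≥0) : ℝ) : ℝ) : ℂ) ^ (-(a + b - 1))) := by
      intro z
      rw [← mul_assoc, hpow, mul_comm]
    simp_rw [hpt]
    rw [integral_const_mul]
  · -- `|x| > 1`: rescale `z ↦ x z`
    have hx0 : x ≠ 0 := by
      rintro rfl
      rw [map_zero] at hx
      exact not_lt.2 zero_le_one hx
    have hxR : (1 : ℝ) < ((normAbs F x : ℝ≥0) : ℝ) := by exact_mod_cast hx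
    have hxpos : (0 : ℝ) < ((normAbs F x : ℝ≥0) : ℝ) := one_pos.trans hxR
    have hxC : (((normAbs F x : ℝ≥0) : ℝ) : ℂ) ≠ 0 := by exact_mod_cast hxpos.ne'
    simp_rw [integral_inner_cpow_of_one_lt μ hx]
    have hpt : ∀ z : F, ((max 1 (max ((normAbs F x : ℝ≥0) : ℝ) ((normAbs F z : ℝ≥0) : ℝ)) : ℝ) : ℂ) ^ (-a) *
        (((((normAbs F x : ℝ≥0) : ℝ)⁻¹ : ℝ) : ℂ) * ((((max 1 ((normAbs F (x⁻¹ * z) : ℝ≥0) : ℝ)) : ℝ) : ℂ) ^ (1 - b) *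
          ∫ t, (((max 1 ((normAbs F t : ℝ≥0) : ℝ) : ℝ) : ℂ) ^ (-b)) ∂μ)) =
        (((((normAbs F x : ℝ≥0) : ℝ)) : ℂ) ^ (-a) * ((((normAbs F x : ℝ≥0) : ℝ)⁻¹ : ℝ) : ℂ) * ∫ t, (((max 1 ((normAbs F t : ℝ≥0) : ℝ) : ℝ) : ℂ) ^ (-b)) ∂μ) *
          (((max 1 ((normAbs F (x⁻¹ * z) : ℝ≥0) : ℝ) : ℝ) : ℂ) ^ (-(a + b - 1))) := by
      intro z
      have e1 : ((max 1 (max ((normAbs F x : ℝ≥0) : ℝ) ((normAbs F z : ℝ≥0) : ℝ)) : ℝ) : ℂ) ^ (-a) =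
          (((((normAbs F x : ℝ≥0) : ℝ)) : ℂ) ^ (-a)) * (((max 1 ((normAbs F (x⁻¹ * z) : ℝ≥0) : ℝ) : ℝ) : ℂ) ^ (-a)) := by
        rw [max_one_max_eq_mul hxR.le _, show ((normAbs F x : ℝ≥0) : ℝ)⁻¹ * ((normAbs F z : ℝ≥0) : ℝ) =
          ((normAbs F (x⁻¹ * z) : ℝ≥0) : ℝ) by rw [map_mul, map_inv₀, NNReal.coe_mul, NNReal.coe_inv], Complex.ofReal_mul,
          Complex.mul_cpow_ofReal_nonneg hxpos.le (le_trans zero_le_one (le_max_left _ _))]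
      rw [e1, ← hpow (x⁻¹ * z)]
      ring
    simp_rw [hpt]
    rw [integral_const_mul]
    -- `∫ h(x⁻¹ z) dz = |x| ∫ h`
    have hsub := integral_comp_mul_left μ (inv_ne_zero hx0) (fun t => (((max 1 ((normAbs F t : ℝ≥0) : ℝ) : ℝ) : ℂ) ^ (-(a + b - 1))))
    rw [inv_inv] at hsub
    simp only [Complex.real_smul] at hsub
    rw [hsub, max_eq_right hxR.le, Complex.ofReal_inv]
    field_simp

/-! ## §4 The iterated Gindikin–Karpelevich formula at two complex exponents -/

/-- **GINDIKIN–KARPELEVICH FOR `GL₃(F)` AT TWO COMPLEX EXPONENTS, PRODUCT FORM** (all `a b : ℂ`, unconditional identity of iterated Bochner integrals):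
`∫_x ∫_z ∫_y max(1,|x|,|z|)^{−a}·max(1,|y|,|z−xy|)^{−b} = G(a)·G(b)·G(a+b−1)`, `G(w) = ∫_F max(1,|t|)^{−w} dt`. [cite: Langlands1971, §3] [cite: Casselman1980, Thm. 3.1] -/
theorem integral_bigCell_gl3_cpow_eq_prod (a b : ℂ) :
    ∫ x, ∫ z, ∫ y, ((max 1 (max ((normAbs F x : ℝ≥0) : ℝ) ((normAbs F z : ℝ≥0) : ℝ)) : ℝ) : ℂ) ^ (-a) *
        ((max 1 (max ((normAbs F y : ℝ≥0) : ℝ) ((normAbs F (z - x * y) : ℝ≥0) : ℝ)) : ℝ) : ℂ) ^ (-b) ∂μ ∂μ ∂μ =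
      (∫ t, (((max 1 ((normAbs F t : ℝ≥0) : ℝ) : ℝ) : ℂ) ^ (-a)) ∂μ) * (∫ t, (((max 1 ((normAbs F t : ℝ≥0) : ℝ) : ℝ) : ℂ) ^ (-b)) ∂μ) *
        ∫ t, (((max 1 ((normAbs F t : ℝ≥0) : ℝ) : ℝ) : ℂ) ^ (-(a + b - 1))) ∂μ := by
  simp_rw [integral_integral_bigCellFibre_cpow_eq μ a b]
  rw [integral_mul_const]
  ring

/-- **GINDIKIN–KARPELEVICH FOR `GL₃(F)` AT TWO COMPLEX EXPONENTS, CLOSED FORM** (`1 < Re a`, `1 < Re b`): `∫_x ∫_z ∫_y max(1,|x|,|z|)^{−a}·max(1,|y|,|z−xy|)^{−b}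
= μ(𝒪)³ · (1−q^{−a})(1−q^{−b})(1−q^{−(a+b−1)}) ∕ ((1−q^{1−a})(1−q^{1−b})(1−q^{−(a+b−2)}))` (★ Tate's `G(w)` at `w = a, b, a+b−1`). [cite: Langlands1971, §3]
[cite: Casselman1980, Thm. 3.1] [cite: MoeglinWaldspurger1995, II.1.7] -/
theorem integral_bigCell_gl3_cpow_eq {a b : ℂ} (ha : 1 < a.re) (hb : 1 < b.re) :
    ∫ x, ∫ z, ∫ y, ((max 1 (max ((normAbs F x : ℝ≥0) : ℝ) ((normAbs F z : ℝ≥0) : ℝ)) : ℝ) : ℂ) ^ (-a) *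
        ((max 1 (max ((normAbs F y : ℝ≥0) : ℝ) ((normAbs F (z - x * y) : ℝ≥0) : ℝ)) : ℝ) : ℂ) ^ (-b) ∂μ ∂μ ∂μ =
      ((μ.real (primePowBall F 0) : ℝ) : ℂ) ^ 3 *
        (((1 - (residueFieldCard F : ℂ) ^ (-a)) / (1 - (residueFieldCard F : ℂ) ^ (1 - a))) * ((1 - (residueFieldCard F : ℂ) ^ (-b)) / (1 - (residueFieldCard F : ℂ) ^ (1 - b))) *
          ((1 - (residueFieldCard F : ℂ) ^ (-(a + b - 1))) / (1 - (residueFieldCard F : ℂ) ^ (-(a + b - 2))))) := by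
  have hab : 1 < (a + b - 1).re := by simp; linarith
  rw [integral_bigCell_gl3_cpow_eq_prod, (integrable_and_integral_max_one_normAbs_cpow μ ha).2, (integrable_and_integral_max_one_normAbs_cpow μ hb).2,
    (integrable_and_integral_max_one_normAbs_cpow μ hab).2, show (1 : ℂ) - (a + b - 1) = -(a + b - 2) by ring]
  ring

/-! ## §5 The product-measure form on `F × (F × F)` -/

/-- **THE TWO-EXPONENT INTEGRAND IS INTEGRABLE ON `F × (F × F)`** for `1 < Re a`, `1 < Re b`: continuous, and dominated in norm by ★'s real integrand at
`σ₀ = min(Re a, Re b) > 1` (bases `≥ 1`), which is ★ `integrable_bigCellIntegrand`. [cite: Langlands1971, §3] [cite: Casselman1980, Thm. 3.1] -/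
theorem integrable_bigCellIntegrand_cpow {a b : ℂ} (ha : 1 < a.re) (hb : 1 < b.re) :
    Integrable (fun p : F × (F × F) => ((max 1 (max ((normAbs F p.1 : ℝ≥0) : ℝ) ((normAbs F p.2.1 : ℝ≥0) : ℝ)) : ℝ) : ℂ) ^ (-a) *
      ((max 1 (max ((normAbs F p.2.2 : ℝ≥0) : ℝ) ((normAbs F (p.2.1 - p.1 * p.2.2) : ℝ≥0) : ℝ)) : ℝ) : ℂ) ^ (-b)) (μ.prod (μ.prod μ)) := by
  haveI : T2Space F := (isLocalField F).toT2Space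
  haveI : SecondCountableTopology F := secondCountableTopology_localField F
  have h := @continuous_coe_normAbs F _ _ _ _
  have hσ : 1 < min a.re b.re := lt_min ha hb
  have hcont : Continuous fun p : F × (F × F) => ((max 1 (max ((normAbs F p.1 : ℝ≥0) : ℝ) ((normAbs F p.2.1 : ℝ≥0) : ℝ)) : ℝ) : ℂ) ^ (-a) *
      ((max 1 (max ((normAbs F p.2.2 : ℝ≥0) : ℝ) ((normAbs F (p.2.1 - p.1 * p.2.2) : ℝ≥0) : ℝ)) : ℝ) : ℂ) ^ (-b) := by
    refine Continuous.mul (continuous_coe_max_one_cpow ((h.comp continuous_fst).max (h.comp (continuous_fst.comp continuous_snd))) _)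
      (continuous_coe_max_one_cpow ((h.comp (continuous_snd.comp continuous_snd)).max (h.comp ?_)) _)
    exact (continuous_fst.comp continuous_snd).sub (continuous_fst.mul (continuous_snd.comp continuous_snd))
  refine (integrable_bigCellIntegrand μ hσ).mono' hcont.aestronglyMeasurable (Eventually.of_forall fun p => ?_)
  rw [norm_mul]
  exact mul_le_mul (norm_coe_cpow_neg_le (le_max_left _ _) (min_le_left _ _)) (norm_coe_cpow_neg_le (le_max_left _ _) (min_le_right _ _))
    (norm_nonneg _) (Real.rpow_nonneg (le_trans zero_le_one (le_max_left _ _)) _)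

/-- The `(z,y)`-section of the two-exponent integrand is integrable on `F × F` for `1 < Re a`, `1 < Re b` (dominated by ★ `integrable_zySection` at `σ₀`). [cite: Casselman1980, Thm. 3.1] -/
theorem integrable_zySection_cpow {a b : ℂ} (ha : 1 < a.re) (hb : 1 < b.re) (x : F) :
    Integrable (fun p : F × F => ((max 1 (max ((normAbs F x : ℝ≥0) : ℝ) ((normAbs F p.1 : ℝ≥0) : ℝ)) : ℝ) : ℂ) ^ (-a) *
      ((max 1 (max ((normAbs F p.2 : ℝ≥0) : ℝ) ((normAbs F (p.1 - x * p.2) : ℝ≥0) : ℝ)) : ℝ) : ℂ) ^ (-b)) (μ.prod μ) := by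
  haveI : T2Space F := (isLocalField F).toT2Space
  haveI : SecondCountableTopology F := secondCountableTopology_localField F
  have h := @continuous_coe_normAbs F _ _ _ _
  have hσ : 1 < min a.re b.re := lt_min ha hb
  have hcont : Continuous fun p : F × F => ((max 1 (max ((normAbs F x : ℝ≥0) : ℝ) ((normAbs F p.1 : ℝ≥0) : ℝ)) : ℝ) : ℂ) ^ (-a) *
      ((max 1 (max ((normAbs F p.2 : ℝ≥0) : ℝ) ((normAbs F (p.1 - x * p.2) : ℝ≥0) : ℝ)) : ℝ) : ℂ) ^ (-b) := by
    refine Continuous.mul (continuous_coe_max_one_cpow (continuous_const.max (h.comp continuous_fst)) _)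
      (continuous_coe_max_one_cpow ((h.comp continuous_snd).max (h.comp ?_)) _)
    exact continuous_fst.sub (continuous_const.mul continuous_snd)
  refine (integrable_zySection μ hσ x).mono' hcont.aestronglyMeasurable (Eventually.of_forall fun p => ?_)
  rw [norm_mul]
  exact mul_le_mul (norm_coe_cpow_neg_le (le_max_left _ _) (min_le_left _ _)) (norm_coe_cpow_neg_le (le_max_left _ _) (min_le_right _ _))
    (norm_nonneg _) (Real.rpow_nonneg (le_trans zero_le_one (le_max_left _ _)) _)

/-- **GINDIKIN–KARPELEVICH FOR `GL₃(F)` AT TWO COMPLEX EXPONENTS, HAAR FORM** (`1 < Re a`, `1 < Re b`): the integral over `F × (F × F)` against `μ ⊗ (μ ⊗ μ)` of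
`max(1,|x|,|z|)^{−a}·max(1,|y|,|z−xy|)^{−b}` (coordinates `(x,(z,y))`) equals `μ(𝒪)³ · (1−q^{−a})(1−q^{−b})(1−q^{−(a+b−1)}) ∕ ((1−q^{1−a})(1−q^{1−b})(1−q^{−(a+b−2)}))`
(Fubini twice + §4). [cite: Langlands1971, §3] [cite: Casselman1980, Thm. 3.1] [cite: MoeglinWaldspurger1995, II.1.7] -/
theorem integral_prod_bigCell_gl3_cpow_eq {a b : ℂ} (ha : 1 < a.re) (hb : 1 < b.re) :
    ∫ p : F × (F × F), ((max 1 (max ((normAbs F p.1 : ℝ≥0) : ℝ) ((normAbs F p.2.1 : ℝ≥0) : ℝ)) : ℝ) : ℂ) ^ (-a) *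
        ((max 1 (max ((normAbs F p.2.2 : ℝ≥0) : ℝ) ((normAbs F (p.2.1 - p.1 * p.2.2) : ℝ≥0) : ℝ)) : ℝ) : ℂ) ^ (-b) ∂(μ.prod (μ.prod μ)) =
      ((μ.real (primePowBall F 0) : ℝ) : ℂ) ^ 3 *
        (((1 - (residueFieldCard F : ℂ) ^ (-a)) / (1 - (residueFieldCard F : ℂ) ^ (1 - a))) * ((1 - (residueFieldCard F : ℂ) ^ (-b)) / (1 - (residueFieldCard F : ℂ) ^ (1 - b))) *
          ((1 - (residueFieldCard F : ℂ) ^ (-(a + b - 1))) / (1 - (residueFieldCard F : ℂ) ^ (-(a + b - 2))))) := by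
  haveI : T2Space F := (isLocalField F).toT2Space
  haveI : SecondCountableTopology F := secondCountableTopology_localField F
  haveI : LocallyCompactSpace F := (isLocalField F).toLocallyCompactSpace
  rw [integral_prod _ (integrable_bigCellIntegrand_cpow μ ha hb)]
  have h : ∀ x : F, ∫ p : F × F, ((max 1 (max ((normAbs F x : ℝ≥0) : ℝ) ((normAbs F p.1 : ℝ≥0) : ℝ)) : ℝ) : ℂ) ^ (-a) *
        ((max 1 (max ((normAbs F p.2 : ℝ≥0) : ℝ) ((normAbs F (p.1 - x * p.2) : ℝ≥0) : ℝ)) : ℝ) : ℂ) ^ (-b) ∂(μ.prod μ) =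
      ∫ z, ∫ y, ((max 1 (max ((normAbs F x : ℝ≥0) : ℝ) ((normAbs F z : ℝ≥0) : ℝ)) : ℝ) : ℂ) ^ (-a) *
        ((max 1 (max ((normAbs F y : ℝ≥0) : ℝ) ((normAbs F (z - x * y) : ℝ≥0) : ℝ)) : ℝ) : ℂ) ^ (-b) ∂μ ∂μ := fun x => integral_prod _ (integrable_zySection_cpow μ ha hb x)
  simp_rw [h]
  exact integral_bigCell_gl3_cpow_eq μ ha hb

end Haar

end Summit.HodgeConjecture.HodgeConjecture.Cruxes.H413.K2E1GindikinKarpelevichSplitGL3Cpow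

end
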